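import Summits.AtomisticToContinuum.BoseEinsteinCondensation.Theses.BECZeroCrossingDilute
import Summits.AtomisticToContinuum.BoseEinsteinCondensation.Theses.BECParentAnchor

/-!
# `SchemeTransfer` (stmt-AtomisticToContinuum-13906) is the bare implication stmt-13905 → stmt-8997:
# the reduction lemmas, by name

The rank-3 crux `SchemeTransfer` of route `BECZeroCrossingDilute` is, by `Iff.rfl`, the implication
`NearIsotropicDiluteBEC → PeriodicBEC` between the route's rank-2 lattice crux (stmt-AtomisticToContinuum-13905,
`BECZeroCrossingDilute.NearIsotropicDiluteBEC`) and the shared continuum target stmt-AtomisticToContinuum-8997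
(`BECParentAnchor.PeriodicBEC`: constant-mode BEC for `δ`-near-minimisers of the periodic `N`-body energy on the torus
of side `(N/ρ)^{1/3}` at all small densities, every repulsive finite-range `v`). This file records the three logical
consequences the line leads use (refuter crux-attack 2026-08-15, leads 0/c1/c2 2026-08-17), so that they are importable:

* `schemeTransfer_iff_imp` — `SchemeTransfer ↔ (NearIsotropicDiluteBEC → PeriodicBEC)` (definitional);
* `schemeTransfer_of_periodicBEC` — stmt-8997 ALONE closes the crux (the lattice antecedent is not used): the crux is
  CONDITIONALLY settled on the existing item stmt-AtomisticToContinuum-8997 and closes mechanically when it lands;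
* `schemeTransfer_iff_periodicBEC` — conversely, given the antecedent (the route's own
  rank-2 crux), the crux is EQUIVALENT to stmt-8997: no line for it can be cheaper than thermodynamic-limit BEC itself
  unless it refutes stmt-13905.

No analysis is involved; the content is the calibration (D-0014): the crux carries exactly the open problem
LSSY2005 Ch. 5 behind an antecedent that no declaration in the tree connects to the continuum objects.

References: E. H. Lieb, R. Seiringer, J. P. Solovej, J. Yngvason, *The Mathematics of the Bose Gas and its
Condensation* (2005), §1.2 (1.19) and Ch. 5 p. 42.
-/

namespace Summit.AtomisticToContinuum.BoseEinsteinCondensation.Cruxes.SchemeTransfer.BirthStubs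

open Summit.AtomisticToContinuum.BoseEinsteinCondensation.Theses

/-- **`SchemeTransfer` unfolded by name**: the crux is literally the implication from the route's lattice crux
`NearIsotropicDiluteBEC` (stmt-13905) to the shared continuum target `BECParentAnchor.PeriodicBEC` (stmt-8997);
both sides are syntactically the bodies of those decls, so the equivalence is `Iff.rfl`. [folklore] -/
theorem schemeTransfer_iff_imp :
    BECZeroCrossingDilute.SchemeTransfer ↔
      (BECZeroCrossingDilute.NearIsotropicDiluteBEC → BECParentAnchor.PeriodicBEC) :=
  Iff.rfl

/-- **stmt-8997 closes the crux (conditional settlement).** Near-minimiser periodic BEC for every repulsive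
finite-range potential (`BECParentAnchor.PeriodicBEC`, the open problem LSSY2005 Ch. 5 in its torus form) implies
`SchemeTransfer` outright; the lattice antecedent is discarded. When stmt-AtomisticToContinuum-8997 lands, the crux
stmt-AtomisticToContinuum-13906 closes by `schemeTransfer_of_periodicBEC PeriodicBEC_holds`.
[cite: LSSY2005, Ch. 5 p. 42] -/
theorem schemeTransfer_of_periodicBEC (h : BECParentAnchor.PeriodicBEC) :
    BECZeroCrossingDilute.SchemeTransfer :=
  fun _ => h

/-- **Calibre of the crux, by name.** Under the route's own rank-2 crux the bridge crux `SchemeTransfer` is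
EQUIVALENT to the shared open target stmt-8997 (`BECParentAnchor.PeriodicBEC`): every line for it must prove
thermodynamic-limit continuum BEC outright (or refute stmt-13905, which makes it vacuous). [cite: LSSY2005, Ch. 5 p. 42] -/
theorem schemeTransfer_iff_periodicBEC (hA : BECZeroCrossingDilute.NearIsotropicDiluteBEC) :
    BECZeroCrossingDilute.SchemeTransfer ↔ BECParentAnchor.PeriodicBEC :=
  ⟨fun hT => hT hA, fun h _ => h⟩

/-- **Vacuity channel, by name.** A refutation of the lattice crux stmt-13905 would also settle `SchemeTransfer`
(trivially); recorded so that the two ways the crux can close without new continuum analysis are both in the tree.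
(Leads 0/c1/c2: the channel is closed in practice — `N ∈ {0,1}` satisfy stmt-13905's inequality at every `L, Δ`, so a
violation needs `N ≥ 2 ≤ ν₀L³`, i.e. `L → ∞` as `ν₀ → 0`, and the easy-plane side is the repulsive, condensing one.)
[folklore] -/
theorem schemeTransfer_of_not_nearIsotropicDiluteBEC (h : ¬ BECZeroCrossingDilute.NearIsotropicDiluteBEC) :
    BECZeroCrossingDilute.SchemeTransfer :=
  fun hA => absurd hA h

end Summit.AtomisticToContinuum.BoseEinsteinCondensation.Cruxes.SchemeTransfer.BirthStubs
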